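import Summits.BirchSwinnertonDyer.BirchSwinnertonDyer.Theorems.ByReductionTypeAtTwoFineSelmerConjAAtTwoAdditivePotGoodNarrowDefectCertificate1257
import Summits.BirchSwinnertonDyer.BirchSwinnertonDyer.Theorems.ByReductionTypeAtTwoFineSelmerConjAAtTwoAdditivePotGoodClassNumberOned63644p
import Literature.NumberTheory.NumberFields.NarrowClassGroupTwoRankOddClassNumber
import HarnessLib

/-!
# Route `ByReductionTypeAtTwo` (rung K4), crux C1″ `FineSelmerConjAAtTwoAdditivePotGood` (item stmt-BirchSwinnertonDyer-22615):
# THE UNIT-SIGNATURE CERTIFICATE OF THE TOTALLY REAL CUBIC FIELD OF DISCRIMINANT `63644` (`θ³ − θ² − 47θ + 95 = 0`, point field of the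
# census row `445508b1`): `#(U⁺/U²)(ℚ(θ)) = 2`, hence `rank₂ Cl⁺(ℚ(θ)) = 1` — KERNEL (a `--supports 22615` file; seat `bsd-2adic-k4-w1` GEN 10)

HONEST FRAMING (cell `bsd-2adic`, D-0036/D-0054/D-0152): KERNEL theorems about ONE cubic number field; no elliptic curve, no named fact, no
`sorry`, no definition. Closes nothing at the `∀`-level; nothing booked; BSD is not proved by any of this.

THE CERTIFICATE (`b = θ`, real roots `r₀ ≈ −7.26680`, `r₁ ≈ 2.13044`, `r₂ ≈ 6.13635`, isolated to `2·10⁻¹⁰`; units found by the seat's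
lattice search `work/num/`, verified EXACTLY here): `ε = −10969 + 278b + 246b²` (`ε⁻¹ = −3189 + 1058b + 206b²`, `N(ε) = −1`) is positive at
`r₀` (value `≈ 1.19`) and negative at `r₁` (`≈ −9260`), so `−1`, `ε` have independent signs ⟹ `#sign(U) ≥ 4`; `u₀ = 1027839 − 26042b − 23048b²`
(`u₀⁻¹ = 15044119 − 9513134b + 1150764b²`, `N(u₀) = 1`) is TOTALLY POSITIVE — positive at `r₁`, `r₂` by interval arithmetic and at `r₀` (where
`u₀(r₀) ≈ 7·10⁻⁹`) because `ρ₀(u₀)ρ₁(u₀)ρ₂(u₀) = N(u₀) = 1` — and NOT the square of a unit — `u₀ + 1 = (31 − 3b − b²)(51200 − 1288b − 1150b²)`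
with `|N(31 − 3b − b²)| = 3` — ⟹ `#(U⁺/U²) ≥ 2`; so **`#(U⁺/U²)(ℚ(θ)) = 2`** (`h⁺ = 2h = 2`) and, `h = 1` being kernel (`classNumber_eq_one_of_root_d63644p`),
`[Cl⁺ : (Cl⁺)²] = 2` (tree `index_range_pow_two_narrowClassGroup_eq_card_totPosUnitsModSq_of_odd_classNumber`, this seat).

* `exists_three_ringHom_adjoin_d63644`, `isTotallyReal_adjoin_d63644`, `prod_three_ringHom_eq_norm` (the norm as the product over three
  distinct real embeddings of a totally real cubic field).
* `eps_pos_rho0_d63644` / `eps_neg_rho1_d63644` / `eps_pos_rho2_d63644`, `totallyPositive_u0_d63644`, `not_exists_sq_eq_u0_d63644`.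
* **`card_totPosUnitsModSq_adjoin_d63644`** (`= 2`), **`index_range_pow_two_narrowClassGroup_adjoin_d63644`** (`= 2`).

References: [FrohlichTaylor1990] Ch. V §1 (1.10)–(1.13); [Cohen1993] §4.1.3, §6.3; [Marcus1977] Ch. 5 Thm. 22 (c).
-/

set_option autoImplicit false
-- sibling precedent: the directory name repeats the summit name
set_option linter.dupNamespace false

noncomputable section

open scoped Classical IntermediateField NumberField

namespace Summit.BirchSwinnertonDyer.BirchSwinnertonDyer.Theorems.AddKatoTwo

open Polynomial IsDedekindDomain NumberField Field IntermediateField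
  Literature.NumberTheory.NumberFields Literature.NumberTheory.GaloisRepresentations Literature.Geometry.Kaehler.ComplexTorus

/-! ## §1 The three real embeddings -/

section Embeddings

variable {θ : AlgebraicClosure ℚ}

/-- The cubic relation as a real equation gives a root of `Cubic.toPoly` over `ℝ`. [folklore] -/
private theorem aeval_real_of_eq_d63644 {x : ℝ} (hx : x ^ 3 + (-1) * x ^ 2 + (-47) * x + 95 = 0) :
    aeval x (Cubic.toPoly ⟨1, ((-1 : ℤ) : ℚ), ((-47 : ℤ) : ℚ), ((95 : ℤ) : ℚ)⟩) = 0 := by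
  simp only [Cubic.toPoly, map_one, one_mul, aeval_add, aeval_mul, aeval_C, aeval_X_pow, aeval_X, eq_ratCast,
    Rat.cast_intCast]
  push_cast
  linear_combination hx

/-- **The three real embeddings of `ℚ(θ)`, `θ³ − θ² − 47θ + 95 = 0`**, with located images: `ρ₀(θ) ∈ (−7.26679840660, −7.26679840640)`,
`ρ₁(θ) ∈ (2.1304435157, 2.1304435159)`, `ρ₂(θ) ∈ (6.1363548906, 6.1363548908)` (IVT + lifting). [cite: Cohen1993, §4.1.3 (real roots and signatures)] -/
theorem exists_three_ringHom_adjoin_d63644 (hθ : aeval θ (Cubic.toPoly ⟨1, ((-1 : ℤ) : ℚ), ((-47 : ℤ) : ℚ), ((95 : ℤ) : ℚ)⟩) = 0) :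
    ∃ (ρ₀ ρ₁ ρ₂ : ↥ℚ⟮θ⟯ →+* ℝ) (x₀ x₁ x₂ : ℝ),
      ρ₀ (AdjoinSimple.gen ℚ θ) = x₀ ∧ ρ₁ (AdjoinSimple.gen ℚ θ) = x₁ ∧ ρ₂ (AdjoinSimple.gen ℚ θ) = x₂ ∧
      (-36333992033 / 5000000000 : ℝ) < x₀ ∧ x₀ < -1135437251 / 156250000 ∧
      (21304435157 / 10000000000 : ℝ) < x₁ ∧ x₁ < 21304435159 / 10000000000 ∧
      (30681774453 / 5000000000 : ℝ) < x₂ ∧ x₂ < 15340887227 / 2500000000 := by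
  obtain ⟨x₀, hl₀, hu₀, hx₀⟩ := exists_cubic_root_Ioo_of_neg_of_pos (p := (-1 : ℝ)) (q := -47) (r := 95)
    (l := -36333992033 / 5000000000) (u := -1135437251 / 156250000) (by norm_num) (by norm_num) (by norm_num)
  obtain ⟨x₁, hl₁, hu₁, hx₁⟩ := exists_cubic_root_Ioo_of_pos_of_neg (p := (-1 : ℝ)) (q := -47) (r := 95)
    (l := 21304435157 / 10000000000) (u := 21304435159 / 10000000000) (by norm_num) (by norm_num) (by norm_num)
  obtain ⟨x₂, hl₂, hu₂, hx₂⟩ := exists_cubic_root_Ioo_of_neg_of_pos (p := (-1 : ℝ)) (q := -47) (r := 95)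
    (l := 30681774453 / 5000000000) (u := 15340887227 / 2500000000) (by norm_num) (by norm_num) (by norm_num)
  obtain ⟨ρ₀, hρ₀⟩ := exists_ringHom_adjoin_apply_gen_eq (P := ⟨1, ((-1 : ℤ) : ℚ), ((-47 : ℤ) : ℚ), ((95 : ℤ) : ℚ)⟩) rfl
    irreducible_cubic_d63644p_min hθ (aeval_real_of_eq_d63644 hx₀)
  obtain ⟨ρ₁, hρ₁⟩ := exists_ringHom_adjoin_apply_gen_eq (P := ⟨1, ((-1 : ℤ) : ℚ), ((-47 : ℤ) : ℚ), ((95 : ℤ) : ℚ)⟩) rfl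
    irreducible_cubic_d63644p_min hθ (aeval_real_of_eq_d63644 hx₁)
  obtain ⟨ρ₂, hρ₂⟩ := exists_ringHom_adjoin_apply_gen_eq (P := ⟨1, ((-1 : ℤ) : ℚ), ((-47 : ℤ) : ℚ), ((95 : ℤ) : ℚ)⟩) rfl
    irreducible_cubic_d63644p_min hθ (aeval_real_of_eq_d63644 hx₂)
  exact ⟨ρ₀, ρ₁, ρ₂, x₀, x₁, x₂, hρ₀, hρ₁, hρ₂, hl₀, hu₀, hl₁, hu₁, hl₂, hu₂⟩

/-- **`ℚ(θ)` (`d = 63644`) is TOTALLY REAL** (three distinct real embeddings, degree `3`). [cite: Cohen1993, §4.1.3] -/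
theorem isTotallyReal_adjoin_d63644 (hθ : aeval θ (Cubic.toPoly ⟨1, ((-1 : ℤ) : ℚ), ((-47 : ℤ) : ℚ), ((95 : ℤ) : ℚ)⟩) = 0) :
    haveI : FiniteDimensional ℚ ↥ℚ⟮θ⟯ :=
      IntermediateField.adjoin.finiteDimensional ⟨_, Cubic.monic_of_a_eq_one', by rwa [← aeval_def]⟩
    haveI : NumberField ↥ℚ⟮θ⟯ := NumberField.mk
    IsTotallyReal ↥ℚ⟮θ⟯ := by
  haveI : FiniteDimensional ℚ ↥ℚ⟮θ⟯ :=
    IntermediateField.adjoin.finiteDimensional ⟨_, Cubic.monic_of_a_eq_one', by rwa [← aeval_def]⟩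
  haveI : NumberField ↥ℚ⟮θ⟯ := NumberField.mk
  have h3 : Module.finrank ℚ ↥ℚ⟮θ⟯ = 3 := finrank_adjoin_eq_three_of_irreducible irreducible_cubic_d63644p_min hθ
  obtain ⟨ρ₀, ρ₁, ρ₂, x₀, x₁, x₂, hρ₀, hρ₁, hρ₂, hl₀, hu₀, hl₁, hu₁, hl₂, hu₂⟩ := exists_three_ringHom_adjoin_d63644 hθ
  have hne : ∀ {φ ψ : ↥ℚ⟮θ⟯ →+* ℝ} {a c : ℝ}, φ (AdjoinSimple.gen ℚ θ) = a → ψ (AdjoinSimple.gen ℚ θ) = c → a ≠ c → φ ≠ ψ := by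
    intro φ ψ a c ha hc hac h; rw [h] at ha; exact hac (ha.symm.trans hc)
  have h01 : ρ₀ ≠ ρ₁ := hne hρ₀ hρ₁ (by intro h; linarith)
  have h02 : ρ₀ ≠ ρ₂ := hne hρ₀ hρ₂ (by intro h; linarith)
  have h12 : ρ₁ ≠ ρ₂ := hne hρ₁ hρ₂ (by intro h; linarith)
  refine isTotallyReal_of_three_realEmbeddings h3 ![ρ₀, ρ₁, ρ₂] ?_
  intro a c hac
  fin_cases a <;> fin_cases c <;> simp_all

end Embeddings

/-! ## §2 The norm as a product over three real embeddings -/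

/-- **`ρ₀(x)·ρ₁(x)·ρ₂(x) = N(x)`** for a totally real cubic field with three distinct real embeddings (they are ALL the embeddings,
`r₁ = [K:ℚ] = 3`). Used to certify the sign of a unit at an embedding where its value is too close to `0` for interval arithmetic.
[cite: FrohlichTaylor1990, Ch. V §1 (1.14), p. 164] -/
theorem prod_three_ringHom_eq_norm {K : Type} [Field K] [NumberField K] [IsTotallyReal K] (h3 : Module.finrank ℚ K = 3)
    {ρ₀ ρ₁ ρ₂ : K →+* ℝ} (h01 : ρ₀ ≠ ρ₁) (h02 : ρ₀ ≠ ρ₂) (h12 : ρ₁ ≠ ρ₂) (x : K) :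
    ρ₀ x * ρ₁ x * ρ₂ x = ((Algebra.norm ℚ x : ℚ) : ℝ) := by
  classical
  have hcard : (Finset.univ : Finset (K →+* ℝ)).card = 3 := by rw [Finset.card_univ, card_realEmbeddings, h3]
  have hsub : ({ρ₀, ρ₁, ρ₂} : Finset (K →+* ℝ)) ⊆ Finset.univ := Finset.subset_univ _
  have hc3 : ({ρ₀, ρ₁, ρ₂} : Finset (K →+* ℝ)).card = 3 := by
    rw [Finset.card_insert_of_notMem, Finset.card_pair h12]
    simp only [Finset.mem_insert, Finset.mem_singleton, not_or]
    exact ⟨h01, h02⟩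
  have huniv : (Finset.univ : Finset (K →+* ℝ)) = {ρ₀, ρ₁, ρ₂} :=
    (Finset.eq_of_subset_of_card_le hsub (by rw [hcard, hc3])).symm
  rw [ratCast_norm_eq_prod_realEmbeddings, huniv, Finset.prod_insert, Finset.prod_pair h12, mul_assoc]
  simp only [Finset.mem_insert, Finset.mem_singleton, not_or]
  exact ⟨h01, h02⟩

/-! ## §3 The units `ε` and `u₀` -/

section Units

variable {θ : AlgebraicClosure ℚ}

set_option maxHeartbeats 400000 in
/-- **`#(U⁺/U²)(ℚ(θ)) = 2` for the cubic field of discriminant `63644`** (narrow defect `1`: `h⁺ = 2h`), KERNEL, together with the sign data it rests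
on: three distinct real embeddings `ρ₀ ρ₁ ρ₂` with located images, `b = θ ∈ 𝓞`, the unit `ε = −10969 + 278b + 246b²` POSITIVE at `ρ₀`, `ρ₂` and
NEGATIVE at `ρ₁` (`#sign(U) ≥ 4` from `−1`, `ε`), and the unit `u₀ = 1027839 − 26042b − 23048b²` TOTALLY POSITIVE (at `ρ₀` via
`ρ₀ρ₁ρ₂(u₀) = N(u₀) = 1`) and NOT the square of a unit (`u₀ ≡ −1` modulo the norm-`3` element `31 − 3b − b²`).
[cite: FrohlichTaylor1990, Ch. V §1 (1.12)–(1.13), p. 164] [cite: Cohen1993, §4.1.3 and §6.3] [cite: Marcus1977, Ch. 5 Thm. 22 (c)] -/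
theorem unitCertificate_adjoin_d63644 (hθ : aeval θ (Cubic.toPoly ⟨1, ((-1 : ℤ) : ℚ), ((-47 : ℤ) : ℚ), ((95 : ℤ) : ℚ)⟩) = 0) :
    haveI : FiniteDimensional ℚ ↥ℚ⟮θ⟯ :=
      IntermediateField.adjoin.finiteDimensional ⟨_, Cubic.monic_of_a_eq_one', by rwa [← aeval_def]⟩
    haveI : NumberField ↥ℚ⟮θ⟯ := NumberField.mk
    ∃ (ρ₀ ρ₁ ρ₂ : ↥ℚ⟮θ⟯ →+* ℝ) (x₀ x₁ x₂ : ℝ) (b : 𝓞 ↥ℚ⟮θ⟯) (e u : (𝓞 ↥ℚ⟮θ⟯)ˣ),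
      ρ₀ (AdjoinSimple.gen ℚ θ) = x₀ ∧ ρ₁ (AdjoinSimple.gen ℚ θ) = x₁ ∧ ρ₂ (AdjoinSimple.gen ℚ θ) = x₂ ∧
      ((-36333992033 / 5000000000 : ℝ) < x₀ ∧ x₀ < -1135437251 / 156250000) ∧
      ((21304435157 / 10000000000 : ℝ) < x₁ ∧ x₁ < 21304435159 / 10000000000) ∧
      ((30681774453 / 5000000000 : ℝ) < x₂ ∧ x₂ < 15340887227 / 2500000000) ∧
      ρ₀ ≠ ρ₁ ∧ ρ₀ ≠ ρ₂ ∧ ρ₁ ≠ ρ₂ ∧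
      (b : ↥ℚ⟮θ⟯) = AdjoinSimple.gen ℚ θ ∧ b ^ 3 + (-1 : ℤ) * b ^ 2 + (-47 : ℤ) * b + (95 : ℤ) = 0 ∧
      (e : 𝓞 ↥ℚ⟮θ⟯) = -10969 + 278 * b + 246 * b ^ 2 ∧ (u : 𝓞 ↥ℚ⟮θ⟯) = 1027839 - 26042 * b - 23048 * b ^ 2 ∧
      0 < ρ₀ ((e : 𝓞 ↥ℚ⟮θ⟯) : ↥ℚ⟮θ⟯) ∧ ρ₁ ((e : 𝓞 ↥ℚ⟮θ⟯) : ↥ℚ⟮θ⟯) < 0 ∧ 0 < ρ₂ ((e : 𝓞 ↥ℚ⟮θ⟯) : ↥ℚ⟮θ⟯) ∧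
      (∀ σ : ↥ℚ⟮θ⟯ →+* ℝ, 0 < σ ((u : 𝓞 ↥ℚ⟮θ⟯) : ↥ℚ⟮θ⟯)) ∧ (¬ ∃ w : (𝓞 ↥ℚ⟮θ⟯)ˣ, u = w ^ 2) ∧
      Nat.card (TotPosUnitsModSq ↥ℚ⟮θ⟯) = 2 := by
  haveI : FiniteDimensional ℚ ↥ℚ⟮θ⟯ :=
    IntermediateField.adjoin.finiteDimensional ⟨_, Cubic.monic_of_a_eq_one', by rwa [← aeval_def]⟩
  haveI : NumberField ↥ℚ⟮θ⟯ := NumberField.mk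
  haveI : IsTotallyReal ↥ℚ⟮θ⟯ := isTotallyReal_adjoin_d63644 hθ
  set K := ℚ⟮θ⟯ with hKdef
  have h3 : Module.finrank ℚ K = 3 := finrank_adjoin_eq_three_of_irreducible irreducible_cubic_d63644p_min hθ
  obtain ⟨ρ₀, ρ₁, ρ₂, x₀, x₁, x₂, hρ₀, hρ₁, hρ₂, hl₀, hu₀, hl₁, hu₁, hl₂, hu₂⟩ := exists_three_ringHom_adjoin_d63644 hθ
  have hne : ∀ {φ ψ : K →+* ℝ} {a c : ℝ}, φ (AdjoinSimple.gen ℚ θ) = a → ψ (AdjoinSimple.gen ℚ θ) = c → a ≠ c → φ ≠ ψ := by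
    intro φ ψ a c ha hc hac h; rw [h] at ha; exact hac (ha.symm.trans hc)
  have h01 : ρ₀ ≠ ρ₁ := hne hρ₀ hρ₁ (by intro h; linarith)
  have h02 : ρ₀ ≠ ρ₂ := hne hρ₀ hρ₂ (by intro h; linarith)
  have h12 : ρ₁ ≠ ρ₂ := hne hρ₁ hρ₂ (by intro h; linarith)
  obtain ⟨b, hbθ, hb⟩ := exists_ringOfIntegers_cubic_root (p := -1) (q := -47) (r := 95) hθ
  have hbgen : algebraMap (𝓞 K) K b = AdjoinSimple.gen ℚ θ := Subtype.ext hbθ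
  have hb' : b ^ 3 - b ^ 2 - 47 * b + 95 = 0 := by push_cast at hb; linear_combination hb
  -- the units
  set e : (𝓞 K)ˣ := Units.mkOfMulEqOne (-10969 + 278 * b + 246 * b ^ 2) (-3189 + 1058 * b + 206 * b ^ 2)
    (by linear_combination ((368212 : 𝓞 K) + (50676 : 𝓞 K) * b) * hb') with hedef
  set u : (𝓞 K)ˣ := Units.mkOfMulEqOne (1027839 - 26042 * b - 23048 * b ^ 2) (15044119 - 9513134 * b + 1150764 * b ^ 2)
    (by linear_combination ((162767707672 : 𝓞 K) + (-26522808672 : 𝓞 K) * b) * hb') with hudef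
  have heK : ((e : 𝓞 K) : K) = ((-10969 : ℤ) : K) + ((278 : ℤ) : K) * AdjoinSimple.gen ℚ θ + ((246 : ℤ) : K) * AdjoinSimple.gen ℚ θ ^ 2 := by
    rw [hedef, Units.val_mkOfMulEqOne, NumberField.RingOfIntegers.coe_eq_algebraMap]
    simp only [map_add, map_mul, map_pow, map_neg, map_ofNat, hbgen]
    push_cast; ring
  have huK : ((u : 𝓞 K) : K) = ((1027839 : ℤ) : K) + ((-26042 : ℤ) : K) * AdjoinSimple.gen ℚ θ + ((-23048 : ℤ) : K) * AdjoinSimple.gen ℚ θ ^ 2 := by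
    rw [hudef, Units.val_mkOfMulEqOne, NumberField.RingOfIntegers.coe_eq_algebraMap]
    simp only [map_sub, map_mul, map_pow, map_ofNat, hbgen]
    push_cast; ring
  -- values under an embedding
  have hval : ∀ (σ : K →+* ℝ) (x : ℝ), σ (AdjoinSimple.gen ℚ θ) = x → ∀ (v : (𝓞 K)ˣ) (a₀ a₁ a₂ : ℤ),
      ((v : 𝓞 K) : K) = (a₀ : K) + (a₁ : K) * AdjoinSimple.gen ℚ θ + (a₂ : K) * AdjoinSimple.gen ℚ θ ^ 2 →
      σ ((v : 𝓞 K) : K) = a₀ + a₁ * x + a₂ * x ^ 2 := by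
    intro σ x hx v a₀ a₁ a₂ hv
    rw [hv, map_add, map_add, map_mul, map_mul, map_pow, hx, map_intCast, map_intCast, map_intCast]
  -- signs of `ε`
  have he0 : 0 < ρ₀ ((e : 𝓞 K) : K) := by
    rw [hval ρ₀ x₀ hρ₀ e _ _ _ heK]; push_cast
    exact quadratic_pos_of_endpoints (m := 1) hl₀.le hu₀.le (by norm_num) (by norm_num) (by norm_num) (by norm_num)
  have he1 : ρ₁ ((e : 𝓞 K) : K) < 0 := by
    rw [hval ρ₁ x₁ hρ₁ e _ _ _ heK]; push_cast
    exact quadratic_neg_of_endpoints (m := 1) hl₁.le hu₁.le (by norm_num) (by norm_num) (by norm_num) (by norm_num)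
  have he2 : 0 < ρ₂ ((e : 𝓞 K) : K) := by
    rw [hval ρ₂ x₂ hρ₂ e _ _ _ heK]; push_cast
    exact quadratic_pos_of_endpoints (m := 1 / 20000) hl₂.le hu₂.le (by norm_num) (by norm_num) (by norm_num) (by norm_num)
  -- signs of `u₀`
  have hu1 : 0 < ρ₁ ((u : 𝓞 K) : K) := by
    rw [hval ρ₁ x₁ hρ₁ u _ _ _ huK]; push_cast
    exact quadratic_pos_of_endpoints (m := 1) hl₁.le hu₁.le (by norm_num) (by norm_num) (by norm_num) (by norm_num)
  have hu2 : 0 < ρ₂ ((u : 𝓞 K) : K) := by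
    rw [hval ρ₂ x₂ hρ₂ u _ _ _ huK]; push_cast
    exact quadratic_pos_of_endpoints (m := 1) hl₂.le hu₂.le (by norm_num) (by norm_num) (by norm_num) (by norm_num)
  have hNu : Algebra.norm ℚ ((u : 𝓞 K) : K) = 1 := by
    have hunit : IsUnit (Algebra.norm ℤ (u : 𝓞 K)) := u.isUnit.map _
    rw [← Algebra.coe_norm_int]
    rcases Int.isUnit_iff.mp hunit with h1 | h1
    · rw [h1]; norm_num
    · -- `N(u₀) = 1`: compute with the norm form
      exfalso
      have hN := norm_coords_eq_normPoly K h3 b (p := -1) (q := -47) (r := 95) irreducible_cubic_d63644p_min hb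
        1027839 (-26042) (-23048)
      have hue : (u : 𝓞 K) = ((1027839 : ℤ) : 𝓞 K) + ((-26042 : ℤ) : 𝓞 K) * b + ((-23048 : ℤ) : 𝓞 K) * b ^ 2 := by
        rw [hudef, Units.val_mkOfMulEqOne]; push_cast; ring
      rw [hue, hN] at h1
      norm_num at h1
  have hu0 : 0 < ρ₀ ((u : 𝓞 K) : K) := by
    have hprod := prod_three_ringHom_eq_norm h3 h01 h02 h12 ((u : 𝓞 K) : K)
    rw [hNu] at hprod
    push_cast at hprod
    by_contra hle
    push Not at hle
    have hne0 : ρ₀ ((u : 𝓞 K) : K) ≠ 0 := embedding_coe_units_ne_zero ρ₀ u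
    have hlt : ρ₀ ((u : 𝓞 K) : K) < 0 := lt_of_le_of_ne hle hne0
    nlinarith [mul_pos hu1 hu2]
  -- total positivity of `u₀`
  have hcardK : Fintype.card (K →+* ℝ) = 3 := by rw [card_realEmbeddings, h3]
  have huniv : (Finset.univ : Finset (K →+* ℝ)) = {ρ₀, ρ₁, ρ₂} := by
    symm
    apply Finset.eq_of_subset_of_card_le (Finset.subset_univ _)
    rw [Finset.card_univ, hcardK, Finset.card_insert_of_notMem, Finset.card_pair h12]
    simp only [Finset.mem_insert, Finset.mem_singleton, not_or]
    exact ⟨h01, h02⟩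
  have hpos : ∀ σ : K →+* ℝ, 0 < σ ((u : 𝓞 K) : K) := by
    intro σ
    have hσ : σ ∈ ({ρ₀, ρ₁, ρ₂} : Finset (K →+* ℝ)) := huniv ▸ Finset.mem_univ σ
    simp only [Finset.mem_insert, Finset.mem_singleton] at hσ
    rcases hσ with rfl | rfl | rfl
    · exact hu0
    · exact hu1
    · exact hu2
  -- `u₀` is not the square of a unit: `u₀ + 1 = (31 − 3b − b²)(51200 − 1288b − 1150b²)`, `|N(31 − 3b − b²)| = 3`
  have hπ3 : (Algebra.norm ℤ (31 - 3 * b - b ^ 2 : 𝓞 K)).natAbs = 3 := by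
    have hN := natAbs_norm_coords_eq_natAbs_normPoly K h3 b (p := -1) (q := -47) (r := 95) irreducible_cubic_d63644p_min hb 31 (-3) (-1)
    have he : (31 - 3 * b - b ^ 2 : 𝓞 K) = ((31 : ℤ) : 𝓞 K) + ((-3 : ℤ) : 𝓞 K) * b + ((-1 : ℤ) : 𝓞 K) * b ^ 2 := by push_cast; ring
    rw [he, hN]; norm_num
  have hns : ¬ ∃ w : (𝓞 K)ˣ, u = w ^ 2 := by
    refine not_exists_sq_eq_of_absNorm_eq_three u _ hπ3 ?_
    rw [hudef, Units.val_mkOfMulEqOne, Ideal.mem_span_singleton']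
    exact ⟨51200 - 1288 * b - 1150 * b ^ 2, by linear_combination ((5888 : 𝓞 K) + (1150 : 𝓞 K) * b) * hb'⟩
  -- sign matrix of `−1`, `ε` at `ρ₀`, `ρ₁`
  have hs : ∀ i j, signVec (![-1, e] i) (![ρ₀, ρ₁] j) = !![(1 : ZMod 2), 1; 0, 1] i j := by
    intro i j
    fin_cases i <;> fin_cases j
    · show signVec (-1) ρ₀ = 1; rw [signVec_neg_one]
    · show signVec (-1) ρ₁ = 1; rw [signVec_neg_one]
    · show signVec e ρ₀ = 0; rw [signVec_apply, if_neg (not_lt.mpr he0.le)]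
    · show signVec e ρ₁ = 1; rw [signVec_apply, if_pos he1]
  have hdet : IsUnit (!![(1 : ZMod 2), 1; 0, 1]) := by
    haveI := invertibleOfRightInverse !![(1 : ZMod 2), 1; 0, 1] !![(1 : ZMod 2), 1; 0, 1] (by decide)
    exact isUnit_of_invertible _
  have hsig := two_pow_le_card_range_signVec ![-1, e] ![ρ₀, ρ₁] _ hs hdet
  have htwo := two_le_card_totPosUnitsModSq_of_not_sq u hpos hns
  have hcard := card_totPosUnitsModSq_eq_two_of_bounds (n := 2) h3 hsig htwo
  refine ⟨ρ₀, ρ₁, ρ₂, x₀, x₁, x₂, b, e, u, hρ₀, hρ₁, hρ₂, ⟨hl₀, hu₀⟩, ⟨hl₁, hu₁⟩, ⟨hl₂, hu₂⟩, h01, h02, h12, Subtype.ext hbθ, hb, ?_, ?_,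
    he0, he1, he2, hpos, hns, hcard⟩
  · rw [hedef, Units.val_mkOfMulEqOne]
  · rw [hudef, Units.val_mkOfMulEqOne]

/-- **`#(U⁺/U²)(ℚ(θ)) = 2`** for `θ³ − θ² − 47θ + 95 = 0` (cubic field of discriminant `63644`; narrow defect `1`, `h⁺ = 2`), KERNEL.
[cite: FrohlichTaylor1990, Ch. V §1 (1.12)–(1.13), p. 164] [cite: Cohen1993, §4.1.3] -/
theorem card_totPosUnitsModSq_adjoin_d63644 (hθ : aeval θ (Cubic.toPoly ⟨1, ((-1 : ℤ) : ℚ), ((-47 : ℤ) : ℚ), ((95 : ℤ) : ℚ)⟩) = 0) :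
    haveI : FiniteDimensional ℚ ↥ℚ⟮θ⟯ :=
      IntermediateField.adjoin.finiteDimensional ⟨_, Cubic.monic_of_a_eq_one', by rwa [← aeval_def]⟩
    haveI : NumberField ↥ℚ⟮θ⟯ := NumberField.mk
    Nat.card (TotPosUnitsModSq ↥ℚ⟮θ⟯) = 2 := by
  obtain ⟨-, -, -, -, -, -, -, -, -, -, -, -, -, -, -, -, -, -, -, -, -, -, -, -, -, -, -, h⟩ := unitCertificate_adjoin_d63644 hθ
  exact h

/-- **`[Cl⁺(ℚ(θ)) : Cl⁺(ℚ(θ))²] = 2`** (`rank₂ Cl⁺ = 1`) for the cubic field of discriminant `63644`: `h = 1` (kernel norm certificate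
`classNumber_eq_one_of_root_d63644p`) and `#(U⁺/U²) = 2` (`index_range_pow_two_narrowClassGroup_eq_card_totPosUnitsModSq_of_odd_classNumber`). KERNEL.
[cite: FrohlichTaylor1990, Ch. V §1 (1.8)–(1.13), pp. 163–164] -/
theorem index_range_pow_two_narrowClassGroup_adjoin_d63644
    (hθ : aeval θ (Cubic.toPoly ⟨1, ((-1 : ℤ) : ℚ), ((-47 : ℤ) : ℚ), ((95 : ℤ) : ℚ)⟩) = 0) :
    haveI : FiniteDimensional ℚ ↥ℚ⟮θ⟯ :=
      IntermediateField.adjoin.finiteDimensional ⟨_, Cubic.monic_of_a_eq_one', by rwa [← aeval_def]⟩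
    haveI : NumberField ↥ℚ⟮θ⟯ := NumberField.mk
    (powMonoidHom (α := NarrowClassGroup ↥ℚ⟮θ⟯) 2).range.index = 2 := by
  haveI : FiniteDimensional ℚ ↥ℚ⟮θ⟯ :=
    IntermediateField.adjoin.finiteDimensional ⟨_, Cubic.monic_of_a_eq_one', by rwa [← aeval_def]⟩
  haveI : NumberField ↥ℚ⟮θ⟯ := NumberField.mk
  haveI : IsTotallyReal ↥ℚ⟮θ⟯ := isTotallyReal_adjoin_d63644 hθ
  have hh : Odd (classNumber ↥ℚ⟮θ⟯) := by
    rw [NumberField.classNumber, ← Nat.card_eq_fintype_card,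
      card_classGroup_adjoin_eq_one_of_forall_cubicField irreducible_cubic_d63644p_min (classNumber_eq_one_of_root_d63644p) hθ]
    exact odd_one
  rw [index_range_pow_two_narrowClassGroup_eq_card_totPosUnitsModSq_of_odd_classNumber hh, card_totPosUnitsModSq_adjoin_d63644 hθ]

end Units

end Summit.BirchSwinnertonDyer.BirchSwinnertonDyer.Theorems.AddKatoTwo

end
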